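/-
Copyright (c) 2026. All rights reserved.
Released under Apache 2.0 license as described in the file LICENSE.
Authors: abc-iut cell, F-wave seat abc-iut-f-101 (gen 6), over abc-iut-w6-d025 / abc-iut-L4-t8's sum of `⋉`-carriers
(`Ltimes/LogFrobeniusSettingSum`) and abc-iut-L4-t11's `IotaOver` glue (`Ltimes/LogFrobeniusSettingSumIotaOver`).
-/
import Literature.AnabelianGeometry.AbsoluteAnabelian.Ltimes.LogFrobeniusSettingSumIotaOver
import HarnessLib

/-!
# [AbsTopIII] Def 5.4 (vii): the `TS`-valued `ι_{v,ε}` OF A SUM of `⋉`-carriers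

S. Mochizuki, *Topics in absolute anabelian geometry III*, J. Math. Sci. Univ. Tokyo 22 (2015) [MochizukiAbsTopIII2015],
Def 5.4 (vii) p. 128 (the natural transformations `ι_{v,ε}` along the edges of `Γ⃗^log_v`, `ι⊞_{v,ε}` along those of `Γ⃗^⋉_v`).

Cell row «s_b′@SUM» P1-TS (L4-lead m213/m214, abc-iut-f-101 gen 6): for abc-iut-w6-d025's sum `Lt₁.sum Lt₂` of `⋉`-carriers
(index set `V₁ ⊕ V₂`, global categories `𝒳₁ × 𝒳₂`, `ℰ₁ × ℰ₂`, the other factor's global object riding along at each place):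
* `sumIotaTS` / ★ `TSHomotopies.sum T₁ T₂` — the `TS`-valued homotopy datum of the sum: at a place of the first index set
  `ι_{inl v,ε} = ι₁_{v,ε} × (Λ₂ ⟶ 𝟭)` behind the canonical identification of the source functor (exactly as the sum's `ι⊞`,
  `sumIota`), symmetrically at the places of the second; the printed requirement `ι|_{Γ⃗^⋉} = ι⊞ ▹ (𝒩⊞_v → 𝒩_v)` holds
  componentwise from the factors' (`iota_toTS`);
* ★ `iotaOverTS_sum` — «the `TS`-valued `ι` lie over `Th•[Z]`» is inherited by the sum from the factors, given «`logIsoId` lies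
  over `logOver`» for each factor (as for abc-iut-L4-t11's `iotaOver_sum`, whose free-twist-parameter technique is reused:
  `iotaOverTS_sum_aux_inl/inr`).
MODEL-LEVEL plumbing over OUR successor typing; refereed pre-IUT material; nothing here bears on [IUTchIII] Cor. 3.12; no side taken;
typed ≠ proved.
-/

set_option autoImplicit false

universe u

open CategoryTheory

namespace Literature.AnabelianGeometry.AbsoluteAnabelian

namespace LogFrobeniusSettingLtimes

section Sum

variable {V₁ V₂ : Type u} {isArc₁ : V₁ → Bool} {isArc₂ : V₂ → Bool}
  (Lt₁ : LogFrobeniusSettingLtimes V₁ isArc₁) (Lt₂ : LogFrobeniusSettingLtimes V₂ isArc₂)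

/-- The source of the `TS`-valued `ι` in the sum at `inl v`: `((Λ₁ ⋙ λ₁) ⋙ (𝒩⊞₁ → 𝒩₁)) × Λ₂`.
[cite: MochizukiAbsTopIII2015, Def 5.4 (vii) p. 128] -/
theorem twist_comp_sumLam_forget_inl (c : Bool) (v : V₁) (ν : LogVertex (isArc₁ v)) :
    (frobeniusTwist (Lt₁.log.prod Lt₂.log) c ⋙ sumLam Lt₁ Lt₂ (.inl v) ν) ⋙ sumForget Lt₁ Lt₂ (.inl v) =
      ((frobeniusTwist Lt₁.log c ⋙ Lt₁.lam v ν) ⋙ Lt₁.forget v).prod (frobeniusTwist Lt₂.log c) := by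
  cases c <;> rfl

/-- The same at `inr v`. [cite: MochizukiAbsTopIII2015, Def 5.4 (vii) p. 128] -/
theorem twist_comp_sumLam_forget_inr (c : Bool) (v : V₂) (ν : LogVertex (isArc₂ v)) :
    (frobeniusTwist (Lt₁.log.prod Lt₂.log) c ⋙ sumLam Lt₁ Lt₂ (.inr v) ν) ⋙ sumForget Lt₁ Lt₂ (.inr v) =
      (frobeniusTwist Lt₁.log c).prod ((frobeniusTwist Lt₂.log c ⋙ Lt₂.lam v ν) ⋙ Lt₂.forget v) := by
  cases c <;> rfl

/-- The target of the `TS`-valued `ι` in the sum at `inl v`: `(λ₁ ⋙ (𝒩⊞₁ → 𝒩₁)) × 𝟭`. [cite: MochizukiAbsTopIII2015, Def 5.4 (vii) p. 128] -/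
theorem sumLam_forget_inl (v : V₁) (ν : LogVertex (isArc₁ v)) :
    (Lt₁.lam v ν ⋙ Lt₁.forget v).prod (𝟭 Lt₂.X) = sumLam Lt₁ Lt₂ (.inl v) ν ⋙ sumForget Lt₁ Lt₂ (.inl v) := rfl

/-- The same at `inr v`. [cite: MochizukiAbsTopIII2015, Def 5.4 (vii) p. 128] -/
theorem sumLam_forget_inr (v : V₂) (ν : LogVertex (isArc₂ v)) :
    (𝟭 Lt₁.X).prod (Lt₂.lam v ν ⋙ Lt₂.forget v) = sumLam Lt₁ Lt₂ (.inr v) ν ⋙ sumForget Lt₁ Lt₂ (.inr v) := rfl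

/-- **The `TS`-valued `ι_{v,ε}` of the sum**: `ι₁ × (Λ₂ ⟶ 𝟭)` at `inl v`, `(Λ₁ ⟶ 𝟭) × ι₂` at `inr v`, behind the canonical
identifications of source and target. [cite: MochizukiAbsTopIII2015, Def 5.4 (vii) p. 128] -/
def sumIotaTS (T₁ : Lt₁.TSHomotopies) (T₂ : Lt₂.TSHomotopies) : (v : V₁ ⊕ V₂) →
    {ν₁ ν₂ : LogVertex (Sum.elim isArc₁ isArc₂ v)} → LogEdgeTS (Sum.elim isArc₁ isArc₂ v) ν₁ ν₂ →
    ((frobeniusTwist (Lt₁.log.prod Lt₂.log) ν₁.isPostLog ⋙ sumLam Lt₁ Lt₂ v ν₁) ⋙ sumForget Lt₁ Lt₂ v ⟶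
      sumLam Lt₁ Lt₂ v ν₂ ⋙ sumForget Lt₁ Lt₂ v)
  | .inl v, ν₁, _, ε => eqToHom (twist_comp_sumLam_forget_inl Lt₁ Lt₂ ν₁.isPostLog v ν₁) ≫
      NatTrans.prod (T₁.iota v ε) (Lt₂.twistToId ν₁.isPostLog)
  | .inr v, ν₁, _, ε => eqToHom (twist_comp_sumLam_forget_inr Lt₁ Lt₂ ν₁.isPostLog v ν₁) ≫
      NatTrans.prod (Lt₁.twistToId ν₁.isPostLog) (T₂.iota v ε)

/-- The requirement `ι|_{Γ⃗^⋉} = ι⊞ ▹ (𝒩⊞_v → 𝒩_v)` for the sum, at a place of the FIRST index set, componentwise and for a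
free twist parameter (so that `c = false/true` computes). [cite: MochizukiAbsTopIII2015, Def 5.4 (vii) p. 128] -/
private theorem sumIotaTS_toTS_aux_inl (c : Bool) (v : V₁) (ν₁ ν₂ : LogVertex (isArc₁ v))
    (β : frobeniusTwist Lt₁.log c ⋙ Lt₁.lam v ν₁ ⟶ Lt₁.lam v ν₂) (X : Lt₁.X × Lt₂.X) :
    (eqToHom (twist_comp_sumLam_forget_inl Lt₁ Lt₂ c v ν₁) ≫
        NatTrans.prod (Functor.whiskerRight β (Lt₁.forget v)) (Lt₂.twistToId c)).app X =
      (sumForget Lt₁ Lt₂ (.inl v)).map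
        ((eqToHom (twist_comp_sumLam_inl Lt₁ Lt₂ c v ν₁) ≫ NatTrans.prod β (Lt₂.twistToId c)).app X) := by
  obtain ⟨x₁, x₂⟩ := X
  dsimp only [sumForget, sumLam, sumNplusCat, sumNCat, Cat.of, Bundled.of]
  erw [NatTrans.comp_app, eqToHom_app, NatTrans.comp_app, eqToHom_app, Functor.prod_map]
  apply CategoryTheory.Prod.hom_ext
  · erw [fst_eqToHom_comp_prod_app]
    try erw [fst_eqToHom_comp_prod_app]
    try erw [Functor.map_comp, eqToHom_map]
    try erw [Functor.whiskerRight_app]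
    rfl
  · erw [snd_eqToHom_comp_prod_app]
    try erw [snd_eqToHom_comp_prod_app]
    try erw [Functor.map_comp, eqToHom_map]
    try erw [Functor.whiskerRight_app]
    rfl

/-- The same at a place of the SECOND index set. [cite: MochizukiAbsTopIII2015, Def 5.4 (vii) p. 128] -/
private theorem sumIotaTS_toTS_aux_inr (c : Bool) (v : V₂) (ν₁ ν₂ : LogVertex (isArc₂ v))
    (β : frobeniusTwist Lt₂.log c ⋙ Lt₂.lam v ν₁ ⟶ Lt₂.lam v ν₂) (X : Lt₁.X × Lt₂.X) :
    (eqToHom (twist_comp_sumLam_forget_inr Lt₁ Lt₂ c v ν₁) ≫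
        NatTrans.prod (Lt₁.twistToId c) (Functor.whiskerRight β (Lt₂.forget v))).app X =
      (sumForget Lt₁ Lt₂ (.inr v)).map
        ((eqToHom (twist_comp_sumLam_inr Lt₁ Lt₂ c v ν₁) ≫ NatTrans.prod (Lt₁.twistToId c) β).app X) := by
  obtain ⟨x₁, x₂⟩ := X
  dsimp only [sumForget, sumLam, sumNplusCat, sumNCat, Cat.of, Bundled.of]
  erw [NatTrans.comp_app, eqToHom_app, NatTrans.comp_app, eqToHom_app, Functor.prod_map]
  apply CategoryTheory.Prod.hom_ext
  · erw [fst_eqToHom_comp_prod_app]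
    try erw [fst_eqToHom_comp_prod_app]
    try erw [Functor.map_comp, eqToHom_map]
    try erw [Functor.whiskerRight_app]
    rfl
  · erw [snd_eqToHom_comp_prod_app]
    try erw [snd_eqToHom_comp_prod_app]
    change _ = (Lt₂.forget v).map (eqToHom _ ≫ β.app _)
    erw [Functor.map_comp, eqToHom_map]
    try erw [Functor.whiskerRight_app]
    rfl

/-- ★ **The `TS`-valued homotopy datum of the sum of two `⋉`-carriers** (an inhabitant of abc-iut-L4-t3's `TSHomotopies` at
abc-iut-w6-d025's `Lt₁.sum Lt₂`), from `TS`-data on the factors. [cite: MochizukiAbsTopIII2015, Def 5.4 (vii) p. 128] -/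
def TSHomotopies.sum (T₁ : Lt₁.TSHomotopies) (T₂ : Lt₂.TSHomotopies) : (Lt₁.sum Lt₂).TSHomotopies where
  iota v _ _ ε := sumIotaTS Lt₁ Lt₂ T₁ T₂ v ε
  iota_toTS v ν₁ ν₂ ε := by
    ext X
    rcases v with v | v
    · change (sumIotaTS Lt₁ Lt₂ T₁ T₂ (.inl v) ε.toTS).app X =
        (sumForget Lt₁ Lt₂ (.inl v)).map ((sumIota Lt₁ Lt₂ (.inl v) ε).app X)
      simp only [sumIotaTS, sumIota]
      erw [T₁.iota_toTS v ε]
      exact sumIotaTS_toTS_aux_inl Lt₁ Lt₂ ν₁.isPostLog v ν₁ ν₂ (Lt₁.iota v ε) X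
    · change (sumIotaTS Lt₁ Lt₂ T₁ T₂ (.inr v) ε.toTS).app X =
        (sumForget Lt₁ Lt₂ (.inr v)).map ((sumIota Lt₁ Lt₂ (.inr v) ε).app X)
      simp only [sumIotaTS, sumIota]
      erw [T₂.iota_toTS v ε]
      exact sumIotaTS_toTS_aux_inr Lt₁ Lt₂ ν₁.isPostLog v ν₁ ν₂ (Lt₂.iota v ε) X

/-- the `TS`-valued `ι` of the sum at a place of the first index set. [cite: MochizukiAbsTopIII2015, Def 5.4 (vii) p. 128] -/
theorem TSHomotopies.sum_iota_inl (T₁ : Lt₁.TSHomotopies) (T₂ : Lt₂.TSHomotopies) (v : V₁)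
    {ν₁ ν₂ : LogVertex (isArc₁ v)} (ε : LogEdgeTS (isArc₁ v) ν₁ ν₂) :
    (TSHomotopies.sum Lt₁ Lt₂ T₁ T₂).iota (.inl v) ε =
      eqToHom (twist_comp_sumLam_forget_inl Lt₁ Lt₂ ν₁.isPostLog v ν₁) ≫
        NatTrans.prod (T₁.iota v ε) (Lt₂.twistToId ν₁.isPostLog) := rfl

/-- the `TS`-valued `ι` of the sum at a place of the second index set. [cite: MochizukiAbsTopIII2015, Def 5.4 (vii) p. 128] -/
theorem TSHomotopies.sum_iota_inr (T₁ : Lt₁.TSHomotopies) (T₂ : Lt₂.TSHomotopies) (v : V₂)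
    {ν₁ ν₂ : LogVertex (isArc₂ v)} (ε : LogEdgeTS (isArc₂ v) ν₁ ν₂) :
    (TSHomotopies.sum Lt₁ Lt₂ T₁ T₂).iota (.inr v) ε =
      eqToHom (twist_comp_sumLam_forget_inr Lt₁ Lt₂ ν₁.isPostLog v ν₁) ≫
        NatTrans.prod (Lt₁.twistToId ν₁.isPostLog) (T₂.iota v ε) := rfl


/-! ## «The `TS`-valued `ι` lie over `Th•[Z]`» is inherited by the sum -/

/-- componentwise form of `IotaOverTS` (the associators are identities). [cite: MochizukiAbsTopIII2015, Def 5.4 (vii) p. 128] -/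
theorem TSHomotopies.IotaOverTS.of_app' {V : Type u} {isArc : V → Bool} {Lt : LogFrobeniusSettingLtimes V isArc}
    {T : Lt.TSHomotopies}
    (h : ∀ (v : V) ⦃ν₁ ν₂ : LogVertex (isArc v)⦄ (ε : LogEdgeTS (isArc v) ν₁ ν₂) (X₀ : Lt.X),
      (Lt.toE v).map ((T.iota v ε).app X₀) = (Lt.lamTwistOver v ν₁).hom.app X₀ ≫ (Lt.lamOver v ν₂).inv.app X₀) :
    T.IotaOverTS := by
  intro v ν₁ ν₂ ε
  ext X₀
  simp only [Functor.whiskerRight_app, NatTrans.comp_app, Functor.associator_hom_app, Functor.associator_inv_app]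
  erw [Category.id_comp, Category.comp_id]
  exact h v ε X₀

/-- the `IotaOverTS` equation of the sum at a place of the FIRST index set, componentwise, for a free twist parameter `c`
and an arbitrary `α` in the rôle of `ι₁` (abc-iut-L4-t11's `iotaOver_sum_aux_inl`, one `forget` fewer).
[cite: MochizukiAbsTopIII2015, Def 5.4 (vii) p. 128] -/
theorem iotaOverTS_sum_aux_inl (c : Bool) (v : V₁) (ν₁ ν₂ : LogVertex (isArc₁ v))
    (α : (frobeniusTwist Lt₁.log c ⋙ Lt₁.lam v ν₁) ⋙ Lt₁.forget v ⟶ Lt₁.lam v ν₂ ⋙ Lt₁.forget v) (x₁ : Lt₁.X) (x₂ : Lt₂.X)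
    (e₁ : (Lt₁.toE v).map (α.app x₁) =
      ((Lt₁.lamOver v ν₁).hom.app ((frobeniusTwist Lt₁.log c).obj x₁) ≫ (Lt₁.twistOver c).hom.app x₁) ≫
        (Lt₁.lamOver v ν₂).inv.app x₁)
    (e₂ : Lt₂.proj.map ((Lt₂.twistToId c).app x₂) = (Lt₂.twistOver c).hom.app x₂) :
    ((Lt₁.sum Lt₂).toE (.inl v)).map
        ((eqToHom (twist_comp_sumLam_forget_inl Lt₁ Lt₂ c v ν₁) ≫ NatTrans.prod α (Lt₂.twistToId c)).app (x₁, x₂)) =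
      (((Lt₁.sum Lt₂).lamOver (.inl v) ν₁).hom.app ((frobeniusTwist (Lt₁.sum Lt₂).log c).obj (x₁, x₂)) ≫
          ((Lt₁.sum Lt₂).twistOver c).hom.app (x₁, x₂)) ≫
        ((Lt₁.sum Lt₂).lamOver (.inl v) ν₂).inv.app (x₁, x₂) := by
  cases c
  · dsimp only [LogFrobeniusSettingLtimes.sum, sumToE, sumForget, sumLam, sumLamOver, sumNplusCat, sumNCat, Cat.of,
      Bundled.of, twistOver, twistToId] at e₁ e₂ ⊢
    erw [NatTrans.comp_app, eqToHom_app, Category.assoc]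
    apply CategoryTheory.Prod.hom_ext <;>
      simp [NatTrans.prod_app_fst, NatTrans.prod_app_snd, NatIso.prod_hom, NatIso.prod_inv, Iso.trans_hom, Iso.trans_inv,
        Functor.prod_map]
    · erw [fst_eqToHom_comp_prod_app, eqToHom_refl, Category.id_comp]
      simp only [frobeniusTwist_false, Functor.id_obj, Functor.leftUnitor_hom_app, Category.comp_id] at e₁
      exact e₁
    · erw [snd_eqToHom_comp_prod_app, eqToHom_refl, Category.id_comp, NatTrans.id_app, CategoryTheory.Functor.map_id]
      erw [Category.id_comp]
      rfl
  · dsimp only [LogFrobeniusSettingLtimes.sum, sumToE, sumForget, sumLam, sumLamOver, sumNplusCat, sumNCat, Cat.of,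
      Bundled.of, twistOver, twistToId] at e₁ e₂ ⊢
    erw [NatTrans.comp_app, eqToHom_app, Category.assoc]
    apply CategoryTheory.Prod.hom_ext <;>
      simp [NatTrans.prod_app_fst, NatTrans.prod_app_snd, NatIso.prod_hom, NatIso.prod_inv, Iso.trans_hom, Iso.trans_inv,
        Functor.prod_map]
    · erw [fst_eqToHom_comp_prod_app, eqToHom_refl, Category.id_comp]
      simp only [frobeniusTwist_true, Category.assoc] at e₁
      exact e₁
    · erw [snd_eqToHom_comp_prod_app, eqToHom_refl, Category.id_comp]
      erw [Category.id_comp, Category.comp_id]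
      exact e₂

/-- the same at a place of the SECOND index set. [cite: MochizukiAbsTopIII2015, Def 5.4 (vii) p. 128] -/
theorem iotaOverTS_sum_aux_inr (c : Bool) (v : V₂) (ν₁ ν₂ : LogVertex (isArc₂ v))
    (α : (frobeniusTwist Lt₂.log c ⋙ Lt₂.lam v ν₁) ⋙ Lt₂.forget v ⟶ Lt₂.lam v ν₂ ⋙ Lt₂.forget v) (x₁ : Lt₁.X) (x₂ : Lt₂.X)
    (e₁ : Lt₁.proj.map ((Lt₁.twistToId c).app x₁) = (Lt₁.twistOver c).hom.app x₁)
    (e₂ : (Lt₂.toE v).map (α.app x₂) =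
      ((Lt₂.lamOver v ν₁).hom.app ((frobeniusTwist Lt₂.log c).obj x₂) ≫ (Lt₂.twistOver c).hom.app x₂) ≫
        (Lt₂.lamOver v ν₂).inv.app x₂) :
    ((Lt₁.sum Lt₂).toE (.inr v)).map
        ((eqToHom (twist_comp_sumLam_forget_inr Lt₁ Lt₂ c v ν₁) ≫ NatTrans.prod (Lt₁.twistToId c) α).app (x₁, x₂)) =
      (((Lt₁.sum Lt₂).lamOver (.inr v) ν₁).hom.app ((frobeniusTwist (Lt₁.sum Lt₂).log c).obj (x₁, x₂)) ≫
          ((Lt₁.sum Lt₂).twistOver c).hom.app (x₁, x₂)) ≫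
        ((Lt₁.sum Lt₂).lamOver (.inr v) ν₂).inv.app (x₁, x₂) := by
  cases c
  · dsimp only [LogFrobeniusSettingLtimes.sum, sumToE, sumForget, sumLam, sumLamOver, sumNplusCat, sumNCat, Cat.of,
      Bundled.of, twistOver, twistToId] at e₁ e₂ ⊢
    erw [NatTrans.comp_app, eqToHom_app, Category.assoc]
    apply CategoryTheory.Prod.hom_ext <;>
      simp [NatTrans.prod_app_fst, NatTrans.prod_app_snd, NatIso.prod_hom, NatIso.prod_inv, Iso.trans_hom, Iso.trans_inv,
        Functor.prod_map]
    · erw [fst_eqToHom_comp_prod_app, eqToHom_refl, Category.id_comp, NatTrans.id_app, CategoryTheory.Functor.map_id]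
      erw [Category.id_comp]
      rfl
    · erw [snd_eqToHom_comp_prod_app, eqToHom_refl, Category.id_comp]
      simp only [frobeniusTwist_false, Functor.id_obj, Functor.leftUnitor_hom_app, Category.comp_id] at e₂
      exact e₂
  · dsimp only [LogFrobeniusSettingLtimes.sum, sumToE, sumForget, sumLam, sumLamOver, sumNplusCat, sumNCat, Cat.of,
      Bundled.of, twistOver, twistToId] at e₁ e₂ ⊢
    erw [NatTrans.comp_app, eqToHom_app, Category.assoc]
    apply CategoryTheory.Prod.hom_ext <;>
      simp [NatTrans.prod_app_fst, NatTrans.prod_app_snd, NatIso.prod_hom, NatIso.prod_inv, Iso.trans_hom, Iso.trans_inv,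
        Functor.prod_map]
    · erw [fst_eqToHom_comp_prod_app, eqToHom_refl, Category.id_comp]
      erw [Category.id_comp, Category.comp_id]
      exact e₁
    · erw [snd_eqToHom_comp_prod_app, eqToHom_refl, Category.id_comp]
      simp only [frobeniusTwist_true, Category.assoc] at e₂
      exact e₂

/-- ★ **`IotaOverTS` is inherited by the sum**: if the `TS`-valued `ι` of both factors lie over `Th•[Z]` and each factor's
`logIsoId` lies over its `logOver`, then the `TS`-valued `ι` of the sum's `TS`-datum lie over `Th•[Z] = ℰ₁ × ℰ₂`.
[cite: MochizukiAbsTopIII2015, Def 5.4 (vii) p. 128] -/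
theorem iotaOverTS_sum {T₁ : Lt₁.TSHomotopies} {T₂ : Lt₂.TSHomotopies} (h₁ : T₁.IotaOverTS) (h₂ : T₂.IotaOverTS)
    (hl₁ : ∀ X : Lt₁.X, Lt₁.proj.map (Lt₁.logIsoId.hom.app X) = Lt₁.logOver.hom.app X)
    (hl₂ : ∀ X : Lt₂.X, Lt₂.proj.map (Lt₂.logIsoId.hom.app X) = Lt₂.logOver.hom.app X) :
    (TSHomotopies.sum Lt₁ Lt₂ T₁ T₂).IotaOverTS := by
  apply TSHomotopies.IotaOverTS.of_app'
  rintro (v | v) ν₁ ν₂ ε ⟨x₁, x₂⟩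
  · have e₁ := h₁.app v ε x₁
    dsimp only [LogFrobeniusSettingLtimes.lamTwistOver] at e₁ ⊢
    rw [TSHomotopies.sum_iota_inl]
    simp only [Iso.trans_hom, NatTrans.comp_app, Functor.associator_hom_app, Functor.isoWhiskerLeft_hom,
      Functor.whiskerLeft_app] at e₁ ⊢
    erw [Category.id_comp] at e₁
    erw [Category.id_comp]
    exact iotaOverTS_sum_aux_inl Lt₁ Lt₂ ν₁.isPostLog v ν₁ ν₂ (T₁.iota v ε) x₁ x₂ e₁
      (Lt₂.proj_map_twistToId_app hl₂ ν₁.isPostLog x₂)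
  · have e₂ := h₂.app v ε x₂
    dsimp only [LogFrobeniusSettingLtimes.lamTwistOver] at e₂ ⊢
    rw [TSHomotopies.sum_iota_inr]
    simp only [Iso.trans_hom, NatTrans.comp_app, Functor.associator_hom_app, Functor.isoWhiskerLeft_hom,
      Functor.whiskerLeft_app] at e₂ ⊢
    erw [Category.id_comp] at e₂
    erw [Category.id_comp]
    exact iotaOverTS_sum_aux_inr Lt₁ Lt₂ ν₁.isPostLog v ν₁ ν₂ (T₂.iota v ε) x₁ x₂
      (Lt₁.proj_map_twistToId_app hl₁ ν₁.isPostLog x₁) e₂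

end Sum

end LogFrobeniusSettingLtimes

end Literature.AnabelianGeometry.AbsoluteAnabelian
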